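import Summits.BirchSwinnertonDyer.BirchSwinnertonDyer.Theorems.ByReductionTypeAtTwoMultTransportP49KernelOfLEO
import Literature.NumberTheory.IwasawaTheory.Greenberg2006.CohomologyCofiniteGenerationDischarged
import HarnessLib

/-!
# T-42-mult in the kernel, LVII — P49-KERNEL (15): the ASSEMBLY and the `_of_LEO` reduction of Greenberg's
# Prop. 4.9 WITHOUT the two Poitou–Tate binders (Harari Thm. 17.13 (a), (b)) — Greenberg 2006 Prop. 3.2 is a
# theorem of the tree

Cell `bsd-2adic` (run/shared/lean/pub/bsd-2adic/), seat `bsd-2adic-t42` GEN 26 (memo `t42/DESIGN-T42-ADDENDUM-29`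
§A29.4 = audit-2's hTateEPC ADDENDUM-1 recipe, executed). HONEST FRAMING: research route; THEOREMS ONLY (no `def`,
no named fact, no instance, no `sorry`; no new mathematics — the carrying theorems of files XLIII / XLIX re-landed
with ONE term swapped); nothing booked; BSD is not proved by any of this. PARTITION: X5@2 multiplicative
GV-transport rows (K4ᵐ B1·O1; the PRINT binder P49 = `Greenberg1999.prop49_noFiniteSubmodule_H1Sigma` of
`multCongruenceTransportAtTwo_of_print49`) × all p — reduces-the-named-input-of; bears_on K4 items 19922 / 19923
(`--supports stmt-BirchSwinnertonDyer-19923`).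

## What changes and why

Files XLIII (`…P49KernelAssembly`, `twist_surjective_of_kernelInputs` / `prop49_of_kernelInputs`) and XLIX
(`…P49KernelOfLEO`, `prop49_of_LEO`) carry the binders `hPTb : poitouTate_shaRestricted_tateDual ℚ` (Harari
Thm. 17.13 (b)) and `hPTa : poitouTate_restricted_three_le ℚ` (Harari Thm. 17.13 (a)) for ONE purpose: the cofinite
generation of `H¹(G_{K,S}, 𝒜)` — Greenberg 2006 Prop. 3.2 — obtained there as `prop32_of_poitouTate_at hPTb hPTa`
(Prop. 3.2 ⟸ NSW (8.3.20) ⟸ Poitou–Tate). Since then NSW (8.3.20) / Harari Cor. 17.17 became a tree theorem at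
EVERY number field, real places allowed (`GaloisCohomology.finite_restrictedCohomology_holds`, cell `bsd-eis`), and
with it Greenberg's Prop. 3.2 (`Greenberg2006.prop32_cohomology_isCofinitelyGenerated_holds`, per-field form
`Greenberg2006.prop32_at`). This file re-lands the three carrying theorems with `prop32_of_poitouTate_at hPTb hPTa …`
replaced by `prop32_at …` — proofs otherwise byte-identical — so that NEITHER Poitou–Tate binder is displayed:

* §1 `twist_surjective_of_kernelInputs_noPT` — (P49′) from Greenberg 2006 Prop. 5.2 / Prop. 6.3 / Thm. 1 (i) and the
  kernel inputs (I1)–(I4), for any number field `K`;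
* §2 `prop49_of_kernelInputs_noPT`, `prop49_of_LEO_noPT` — Greenberg's Prop. 4.9 over `ℚ` from the three
  Greenberg-2006 facts and the single input (I1) LEO (files XLIV–XLVIII supply (I2)–(I4) unchanged).

The P49 road keeps `hPTb` at ONE place only — the Ш-duality step of LEO (file LVI :165, `E[p^k](χ_u)`), re-landed in
the sibling file LVIII (`…P49KernelLEONoPTa`) with `hPTa` gone: P49 ⟸ PRINT⁴ {Prop. 5.2, Prop. 6.3, Thm. 1 (i),
Thm. 17.13 (b)} + kernel (was PRINT⁵).

References: [GreenbergLNM1716] §4 Props. 4.9, 4.10, pp. 112–118; [Greenberg2006] Thm. 1, Props. 2.4, 3.2, 5.2, 6.3;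
[Greenberg2016Selmer] Prop. 2.6.1, §4.3; [NeukirchSchmidtWingberg2008] (8.3.20); [Harari2020] Cor. 17.17.
-/

set_option autoImplicit false
set_option linter.dupNamespace false

noncomputable section

open scoped Classical

namespace Summit.BirchSwinnertonDyer.BirchSwinnertonDyer.Theorems.P49Kernel

open NumberField IsDedekindDomain Field WeierstrassCurve IsLocalRing
  Literature.NumberTheory.EllipticCurves Literature.NumberTheory.EllipticCurves.BigGaloisRep
  Literature.NumberTheory.EllipticCurves.GreenbergVatsal2000 Literature.NumberTheory.EllipticCurves.Greenberg1999
  Literature.NumberTheory.GaloisRepresentations Literature.NumberTheory.GaloisCohomology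
  Literature.NumberTheory.IwasawaTheory.Greenberg2006 Literature.NumberTheory.IwasawaTheory.Greenberg2016
  Summit.BirchSwinnertonDyer.BirchSwinnertonDyer.Theorems.SignedBaseChangeAcDivCofree
  Summit.BirchSwinnertonDyer.BirchSwinnertonDyer.Theorems.SignedBaseChangeAcDivCurveModel

/-! ## §1. The engine run without Poitou–Tate binders -/

section Engine

variable {K : Type} [Field K] [NumberField K] {p : ℕ} [Fact p.Prime]
  [TopologicalSpace (IwasawaAlgebra p)] [DiscreteTopology (IwasawaAlgebra p)] [IsTopologicalRing (IwasawaAlgebra p)]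
  (W : WeierstrassCurve K) [W.IsElliptic] (κ : ZpExtension K p) (γ : absoluteGaloisGroup K)
  (S₀ : Set (HeightOneSpectrum (𝓞 K)))

/-- **(P49′) from the kernel inputs, no Poitou–Tate binder.** `S ⊇ {v ∣ p}` finite, ANY continuous `Λ`-linear action
`ρ` of `G_{K,S}` on `𝒜 = E[p^∞] ⊗ Λ^*`. GRANTED Greenberg 2006 Prop. 5.2 / Prop. 6.3 / Thm. 1 (i) (named facts) and
GIVEN (I1) `LEO S ρ`, (I2) `LOC1` at a finite `η ∈ S`, (I3) `LOC2` at every place of `Σ`, (I4) an additive bijection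
`Sh : H¹(G_{K,S}, 𝒜) ≃+ unramifiedOutside (ker κ) E[p^∞] p S₀` with `Sh(θ_u • x) = u • conj_γ (Sh x) − Sh x`: there is
`u ≡ 1 (mod p)` such that `c ↦ u • conj_γ c − c` maps `H¹(K_Σ/K_∞, E[p^∞])` ONTO itself. = file XLIII's
`twist_surjective_of_kernelInputs` with the cofinite generation of `H¹` (Greenberg 2006 Prop. 3.2) supplied by the
tree theorem `Greenberg2006.prop32_at` instead of `prop32_of_poitouTate_at hPTb hPTa`.
[cite: GreenbergLNM1716, Props. 4.9, 4.10, pp. 112–117] [cite: Greenberg2006, Thm. 1, Props. 2.4, 3.2, 6.10]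
[cite: Greenberg2016Selmer, Prop. 2.6.1, §4.3 p. 20] [cite: NeukirchSchmidtWingberg2008, (8.3.20)] -/
theorem twist_surjective_of_kernelInputs_noPT
    (h52 : prop52_localH2_torsionBy_injective) (h63 : prop63_shaAway_smul_surjective)
    (hT1 : thm1_sha2_isCoreflexive)
    {S : Set (HeightOneSpectrum (𝓞 K))} (hS : S.Finite)
    (hSp : ∀ v : HeightOneSpectrum (𝓞 K), ((p : ℕ) : 𝓞 K) ∈ v.asIdeal → v ∈ S)
    (ρ : ContinuousRep (GaloisGroupUnramifiedOutside K S) (IwasawaAlgebra p)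
      (BigRepModule ℤ_[p] p (PrimaryTorsion W.geomPoints p)))
    (hLEO : LEO S ρ) {η : HeightOneSpectrum (𝓞 K)} (hη : η ∈ S) (hLOC1 : LOC1 S ρ (Sum.inr η))
    (hLOC2 : ∀ v : Place K, InSigma S v → LOC2 S ρ v)
    (Sh : ρ.H 1 ≃+ unramifiedOutside κ.kerSubgroup (W.geomPrimaryTorsion p) p S₀)
    (hSh : ∀ (u : ℤ) (x : ρ.H 1),
      (Sh ((PowerSeries.C ((u : ℤ_[p])) * PowerSeries.X + PowerSeries.C ((u : ℤ_[p]) - 1) :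
          IwasawaAlgebra p) • x) : W.subgroupH1 p κ.kerSubgroup) =
        u • W.conjH1 p κ.kerSubgroup γ (Sh x) - Sh x) :
    ∃ u : ℤ, (p : ℤ) ∣ u - 1 ∧
      ∀ c ∈ unramifiedOutside κ.kerSubgroup (W.geomPrimaryTorsion p) p S₀,
        ∃ c' ∈ unramifiedOutside κ.kerSubgroup (W.geomPrimaryTorsion p) p S₀,
          u • W.conjH1 p κ.kerSubgroup γ c' - c' = c := by
  obtain ⟨e⟩ := nonempty_ringEquiv_mvPowerSeries_fin_one p
  have hpD := exists_pow_zsmul_eq_zero_bigRepModule p W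
  have hD := isCofinitelyGenerated_bigRepModule p W
  -- cofinite generation of `H¹` (Greenberg 2006 Prop. 3.2 — tree theorem `prop32_at`)
  have hfg : IsCofinitelyGenerated (IwasawaAlgebra p) (ρ.H 1) := (prop32_at S hS hSp e ρ hD).1 1
  -- the engine: `H¹(G_{K,S}, 𝒜)` is almost divisible
  have had : IsAlmostDivisible (IwasawaAlgebra p) (ρ.H 1) :=
    isAlmostDivisible_H_one_of_facts h52 h63 hT1 hS hSp e ρ hpD hD (rfx_bigRepModule p W) hLEO hLOC2 hη
      hLOC1 hfg
  -- Prop. 2.4: `π • H¹ = H¹` off a finite set of primes of height `≤ 1`; pick a twist element off it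
  haveI : IsNoetherianRing (IwasawaAlgebra p) := isNoetherianRing_of_ringEquiv_mvPowerSeries e
  obtain ⟨F, hF, hF1, hdiv⟩ := had.exists_finite_forall_smul_surjective hfg
  obtain ⟨u, hu, huF⟩ := exists_int_twistElement_notMem_of_finite hF hF1
  refine ⟨u, hu, fun c hc ↦ ?_⟩
  obtain ⟨x', hx'⟩ := hdiv _ huF (Sh.symm ⟨c, hc⟩)
  refine ⟨Sh x', (Sh x').2, ?_⟩
  have h := hSh u x'
  simp only at hx'
  rw [hx', AddEquiv.apply_symm_apply] at h
  exact h.symm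

end Engine

/-! ## §2. Over `ℚ`: Greenberg's Prop. 4.9 from the three Greenberg-2006 facts and the kernel inputs / LEO -/

section Rat

/-- A finite place above `p` (lying-over for `ℤ ⊆ 𝓞 K`; verbatim from file XLIX). [folklore] -/
private theorem exists_place_natCast_mem' {K : Type} [Field K] [NumberField K] (p : ℕ) [Fact p.Prime] :
    ∃ v : HeightOneSpectrum (𝓞 K), ((p : ℕ) : 𝓞 K) ∈ v.asIdeal := by
  have hp : p.Prime := Fact.out
  have hp' : Prime (p : ℤ) := Nat.prime_iff_prime_int.mp hp
  haveI : (Ideal.span {(p : ℤ)}).IsPrime := (Ideal.span_singleton_prime hp'.ne_zero).mpr hp'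
  have hinj : Function.Injective (algebraMap ℤ (𝓞 K)) := (algebraMap ℤ (𝓞 K)).injective_int
  obtain ⟨Q, -, hQ, hQp⟩ := Ideal.exists_ideal_over_prime_of_isIntegral
    (S := 𝓞 K) (Ideal.span {(p : ℤ)}) ⊥
    (by
      rw [← RingHom.ker_eq_comap_bot, (RingHom.injective_iff_ker_eq_bot _).mp hinj]
      exact bot_le)
  have hmem : (p : ℤ) ∈ Q.comap (algebraMap ℤ (𝓞 K)) := by
    rw [hQp]
    exact Ideal.mem_span_singleton_self _
  have hQne : Q ≠ ⊥ := by
    intro hQbot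
    rw [hQbot, Ideal.mem_comap, Ideal.mem_bot] at hmem
    exact hp'.ne_zero (hinj (by rw [hmem, map_zero]))
  refine ⟨⟨Q, hQ, hQne⟩, ?_⟩
  have := Ideal.mem_comap.mp hmem
  rwa [map_natCast] at this

/-- **`prop49_noFiniteSubmodule_H1Sigma` from the kernel inputs over `ℚ`, no Poitou–Tate binder.** GRANTED the three
Greenberg-2006 named facts: if at the binders of LNM 1716 Prop. 4.9 there are a finite `S ⊇ {v ∣ p}`, a continuous
`Λ`-linear action `ρ` of `G_{ℚ,S}` on `𝒜 = E[p^∞] ⊗ Λ^*`, with (I1) LEO, (I2) LOC1 at a finite `η ∈ S`, (I3) LOC2 on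
`Σ`, and (I4) a Shapiro bridge intertwining `θ_u` with `u·conj_γ − 1`, then Prop. 4.9 holds — §1 and brick B1
(`prop49_noFiniteSubmodule_H1Sigma_of_twist_surjective`). = file XLIII's `prop49_of_kernelInputs`, Prop. 3.2 by name.
[cite: GreenbergLNM1716, Prop. 4.9 and its proof, pp. 112–118] [cite: Greenberg2006, Thm. 1, Prop. 3.2]
[cite: Greenberg2016Selmer, Prop. 2.6.1] -/
theorem prop49_of_kernelInputs_noPT
    (h52 : prop52_localH2_torsionBy_injective) (h63 : prop63_shaAway_smul_surjective)
    (hT1 : thm1_sha2_isCoreflexive)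
    (hIn : ∀ (W : WeierstrassCurve ℚ) [W.IsElliptic] [W.IsGloballyMinimal] (p : ℕ) [Fact p.Prime]
      (κ : ZpExtension ℚ p) (γ : absoluteGaloisGroup ℚ), κ.IsCyclotomic → κ.IsTopGenerator γ →
      ∀ (S₀ : Finset (HeightOneSpectrum (𝓞 ℚ))),
        (∀ v : HeightOneSpectrum (𝓞 ℚ), v ∉ S₀ → ((p : ℕ) : 𝓞 ℚ) ∉ v.asIdeal →
          W.HasGoodReductionAt v) →
      ∀ (D : W.SelmerDualData κ γ), D.IsTorsion →
      letI : TopologicalSpace (IwasawaAlgebra p) := ⊥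
      ∀ [DiscreteTopology (IwasawaAlgebra p)] [IsTopologicalRing (IwasawaAlgebra p)],
      ∃ (S : Set (HeightOneSpectrum (𝓞 ℚ))) (_ : S.Finite)
        (_ : ∀ v : HeightOneSpectrum (𝓞 ℚ), ((p : ℕ) : 𝓞 ℚ) ∈ v.asIdeal → v ∈ S)
        (ρ : ContinuousRep (GaloisGroupUnramifiedOutside ℚ S) (IwasawaAlgebra p)
          (BigRepModule ℤ_[p] p (PrimaryTorsion W.geomPoints p)))
        (η : HeightOneSpectrum (𝓞 ℚ))
        (Sh : ρ.H 1 ≃+ unramifiedOutside κ.kerSubgroup (W.geomPrimaryTorsion p) p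
          (↑S₀ : Set (HeightOneSpectrum (𝓞 ℚ)))),
        LEO S ρ ∧ η ∈ S ∧ LOC1 S ρ (Sum.inr η) ∧ (∀ v : Place ℚ, InSigma S v → LOC2 S ρ v) ∧
        (∀ (u : ℤ) (x : ρ.H 1),
          (Sh ((PowerSeries.C ((u : ℤ_[p])) * PowerSeries.X + PowerSeries.C ((u : ℤ_[p]) - 1) :
              IwasawaAlgebra p) • x) : W.subgroupH1 p κ.kerSubgroup) =
            u • W.conjH1 p κ.kerSubgroup γ (Sh x) - Sh x)) :
    prop49_noFiniteSubmodule_H1Sigma := by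
  refine prop49_noFiniteSubmodule_H1Sigma_of_twist_surjective ?_
  intro W _ _ p _ κ γ hκ hγ S₀ hbad D hD
  letI : TopologicalSpace (IwasawaAlgebra p) := ⊥
  haveI : DiscreteTopology (IwasawaAlgebra p) := ⟨rfl⟩
  haveI : ContinuousAdd (IwasawaAlgebra p) := ⟨continuous_of_discreteTopology⟩
  haveI : ContinuousMul (IwasawaAlgebra p) := ⟨continuous_of_discreteTopology⟩
  haveI : ContinuousNeg (IwasawaAlgebra p) := ⟨continuous_of_discreteTopology⟩
  haveI : IsTopologicalRing (IwasawaAlgebra p) := IsTopologicalRing.mk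
  obtain ⟨S, hS, hSp, ρ, η, Sh, hLEO, hη, hLOC1, hLOC2, hSh⟩ := hIn W p κ γ hκ hγ S₀ hbad D hD
  exact twist_surjective_of_kernelInputs_noPT W κ γ _ h52 h63 hT1 hS hSp ρ hLEO hη hLOC1 hLOC2 Sh hSh

/-- **Greenberg's Prop. 4.9 over `ℚ` from the three Greenberg-2006 facts and the ONE remaining input (I1) LEO, no
Poitou–Tate binder.** GIVEN, at the binders of LNM 1716 Prop. 4.9 and for every continuous `ℤ_p`-linear model `ρ₀` of
`E[p^∞]` over `G_{ℚ,S}`, `S = Σ₀ ∪ {p}`, with `ρ₀(σ mod N_S) = σ`, the hypothesis LEO: `Ш²(ℚ, Σ, E[p^∞] ⊗ Λ^*(κ̄⁻¹))`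
is `Λ`-cotorsion, Prop. 4.9 holds. = file XLIX's `prop49_of_LEO` on top of `prop49_of_kernelInputs_noPT`: `ρ₀` from
`exists_continuousRep_primaryTorsion`, (I2) `loc1_bigRep_primaryTorsion_rat`, (I3) `loc2_bigRep_primaryTorsion`, (I4)
`exists_shapiro_bridge`. [cite: GreenbergLNM1716, Prop. 4.9 and its proof, pp. 112–118]
[cite: Greenberg2006, Thm. 1, Prop. 2.4, Prop. 3.2] [cite: Greenberg2016Selmer, Prop. 2.6.1, §4.3 p. 20] -/
theorem prop49_of_LEO_noPT
    (h52 : prop52_localH2_torsionBy_injective) (h63 : prop63_shaAway_smul_surjective)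
    (hT1 : thm1_sha2_isCoreflexive)
    (hLEO : ∀ (W : WeierstrassCurve ℚ) [W.IsElliptic] [W.IsGloballyMinimal] (p : ℕ) [Fact p.Prime]
      (κ : ZpExtension ℚ p) (γ : absoluteGaloisGroup ℚ), κ.IsCyclotomic → κ.IsTopGenerator γ →
      ∀ (S₀ : Finset (HeightOneSpectrum (𝓞 ℚ))),
        (∀ v : HeightOneSpectrum (𝓞 ℚ), v ∉ S₀ → ((p : ℕ) : 𝓞 ℚ) ∉ v.asIdeal →
          W.HasGoodReductionAt v) →
      ∀ (D : W.SelmerDualData κ γ), D.IsTorsion →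
      letI : TopologicalSpace (IwasawaAlgebra p) := ⊥
      ∀ [DiscreteTopology (IwasawaAlgebra p)] [IsTopologicalRing (IwasawaAlgebra p)]
        (ρ₀ : ContinuousRep (GaloisGroupUnramifiedOutside ℚ
            ((↑S₀ : Set (HeightOneSpectrum (𝓞 ℚ))) ∪
              {v : HeightOneSpectrum (𝓞 ℚ) | ((p : ℕ) : 𝓞 ℚ) ∈ v.asIdeal}))
          ℤ_[p] (PrimaryTorsion W.geomPoints p)),
        (∀ (σ : absoluteGaloisGroup ℚ) (P : PrimaryTorsion W.geomPoints p),
          ρ₀ (toUnramifiedQuot ℚ _ σ) P = σ • P) →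
        LEO ((↑S₀ : Set (HeightOneSpectrum (𝓞 ℚ))) ∪
            {v : HeightOneSpectrum (𝓞 ℚ) | ((p : ℕ) : 𝓞 ℚ) ∈ v.asIdeal})
          (bigRep (κ.liftUnramifiedOutside _ (mem_union_setOf_natCast_mem p S₀)) ρ₀)) :
    prop49_noFiniteSubmodule_H1Sigma := by
  refine prop49_of_kernelInputs_noPT h52 h63 hT1 ?_
  intro W _ _ p _ κ γ hκ hγ S₀ hbad D hD
  letI : TopologicalSpace (IwasawaAlgebra p) := ⊥
  intro _ _
  -- the set `S = Σ₀ ∪ {v ∣ p}` and the descended model `ρ₀` of `E[p^∞]` over `G_{ℚ,S}`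
  have hS : (((↑S₀ : Set (HeightOneSpectrum (𝓞 ℚ))) ∪
      {v : HeightOneSpectrum (𝓞 ℚ) | ((p : ℕ) : 𝓞 ℚ) ∈ v.asIdeal})).Finite :=
    finite_union_setOf_natCast_mem p (Fact.out : p.Prime).ne_zero S₀
  have hSp := mem_union_setOf_natCast_mem (K := ℚ) p S₀
  have hSbad : ∀ w : HeightOneSpectrum (𝓞 ℚ), ¬ W.HasGoodReductionAt w →
      w ∈ ((↑S₀ : Set (HeightOneSpectrum (𝓞 ℚ))) ∪
        {v : HeightOneSpectrum (𝓞 ℚ) | ((p : ℕ) : 𝓞 ℚ) ∈ v.asIdeal}) := fun w hw ↦ by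
    by_contra h
    exact hw (hbad w (fun h' ↦ h (Or.inl h')) (fun h' ↦ h (Or.inr h')))
  have hNS : ∀ n ∈ ramificationSubgroup ℚ (((↑S₀ : Set (HeightOneSpectrum (𝓞 ℚ))) ∪
      {v : HeightOneSpectrum (𝓞 ℚ) | ((p : ℕ) : 𝓞 ℚ) ∈ v.asIdeal})),
      ∀ P : PrimaryTorsion W.geomPoints p, n • P = P := fun n hn P ↦
    smul_primaryTorsion_eq_of_mem_ramificationSubgroup W p _ hSbad hSp hn P
  obtain ⟨ρ₀, hρ₀⟩ := exists_continuousRep_primaryTorsion W p _ hNS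
  obtain ⟨η, hη⟩ := exists_place_natCast_mem' (K := ℚ) p
  -- (I4) the Shapiro bridge
  obtain ⟨Sh, hSh⟩ := exists_shapiro_bridge W κ γ hγ (S₀ := (↑S₀ : Set (HeightOneSpectrum (𝓞 ℚ))))
    Set.subset_union_left hSp (fun v hv₀ hpv hv ↦ hv.elim hv₀ hpv) hNS
    (bigRep (κ.liftUnramifiedOutside _ hSp) ρ₀) (bigRep_lift_mk_apply W κ hSp ρ₀ hρ₀)
  exact ⟨_, hS, hSp, bigRep (κ.liftUnramifiedOutside _ hSp) ρ₀, η, Sh,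
    hLEO W p κ γ hκ hγ S₀ hbad D hD ρ₀ hρ₀, hSp η hη, loc1_bigRep_primaryTorsion_rat hκ hSp W ρ₀ hη,
    fun v _ ↦ loc2_bigRep_primaryTorsion _ W ρ₀ v, hSh⟩

end Rat

end Summit.BirchSwinnertonDyer.BirchSwinnertonDyer.Theorems.P49Kernel

end
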